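import Literature.MathematicalPhysics.QuantumFieldTheory.Balaban1983to89.B9Eq346GradGpDivAtPinsL2

/-!
# `Balaban1983to89.B9Eq346GradGpDivAtPinsL2Closed` — [B9] Thm 3.1 (3.46)₄ for `G′` in block-`L²` at the N06 certificate's letters: dag-n06-w7's member-uniform
# theorem `B9Eq346GradGpDivAtPinsL2.blockBd_DvGcoSDvs_memberY_regime` WITH ITS FOUR EXISTENTIAL CONSTANTS NAMED (`M46 a46 B46 δ46`) — the closed terms the
# certificate's displayed numerics refer to

T. Bałaban, *Propagators for lattice gauge theories in a background field*, Commun. Math. Phys. **99** (1985) 389–434 [`Balaban1985BackgroundPropagators`, "B9"],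
Thm 3.1 (3.46) p. 398 (the order-zero entry `∇_U G′(U) ∇*_U`), (3.35) p. 396; T. Bałaban, *Propagators and renormalization transformations for lattice gauge
theories. II*, Commun. Math. Phys. **96** (1984) 223–250 [`Balaban1984PropagatorsII`], (2.46) p. 231, (2.51)–(2.54) pp. 232–233.

statement-level skeleton of published theorems with citation tags; proofs where landed; nothing here is a claim about the Yang–Mills mass gap

WHY THIS FILE (cell `pub-ymgap`, Track A node N06 [B9]; text by the knit seat `pub-ymgap-dag-n06-d` (g10) of the stage-11 certificate, filed by the width seat
`pub-ymgap-dag-n06-w7` (g0) whose W-e input hand it closes; pub-ymgap bus 2026-08-28, dag-lead DEDUP-388 (2)(c)).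
dag-n06-w7's `blockBd_DvGcoSDvs_memberY_regime` (p610292) proves the certificate's displayed letter `h46` (edition 28 `…V6EPairNI`) in the shape
`∃ M₄ a₄ B₄ δ₄ > 0, ∀ hG x, M₄ ≤ M_x → ∀ α₀ > 0, M_x·α₀ ≤ a₄ → ∀ U, Reg335 c α₀ U → ∀ bI hlev hβ1 R₀ H₀, BlockBd (blkBK bI) (blkBK bI) (D_U G′ D*_U) (B₄·e^{−δ₄ d})`.
The certificate cannot open this `∃` INSIDE its proof: its displayed numerics carry the side conditions `hrT4 : rT ≤ δ₄` and `hδTr : δT12 + 2σS + 3·(…) ≤ rT`, which tie `δ₄` to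
rates shared with OTHER displayed letters (`hT2L2`, `hta₂ …`, `hL3131H` at rate `δT12`) — so `δ₄` (and `B₄`, and the thresholds `M₄ a₄`) must be TERMS of the statement.  This file
names them by `Classical.choose` — `M46 a46 B46 δ46` (functions of `d ℓ hd hL b₀ b₁ M⋆ N c` and the proof `hc : 0 < c`) — and restates dag-n06-w7's theorem AT THEM
(`blockBd_DvGcoSDvs_memberY_at`), with the four positivity facts.  Nothing is re-proved; nothing of [B9] is asserted beyond p610292.

HONEST SCOPE.  Four named constants and one specialisation; COUNT-NEUTRAL; N06 NOT discharged; one finite lattice programme — nothing continuum, nothing about OS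
positivity or the mass gap.
-/

noncomputable section

namespace Literature.MathematicalPhysics.QuantumFieldTheory.Balaban1983to89.B9Eq346GradGpDivAtPinsL2Closed

open Literature.MathematicalPhysics.QuantumFieldTheory.Balaban1983to89
open Node00 B6KLevelCensusIndexV1 B6Geom246MultiLevelBox B6MultiLevelTorusOperator B6GlobalChartV1 B9BackgroundsKLevelV1 B6Geom246MultiLevelTorus
open Literature.MathematicalPhysics.QuantumFieldTheory.Balaban1983to89.B6Ineq2142KLevelV1 (lvl β)
open Literature.MathematicalPhysics.QuantumFieldTheory.Balaban1983to89.B9CoReadingCoords (XBK blkBK)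
open Literature.MathematicalPhysics.QuantumFieldTheory.Balaban1983to89.B9CoReadingCoordsS (XSK GcoS)
open Literature.MathematicalPhysics.QuantumFieldTheory.Balaban1983to89.B9CoReadingCoordsTranspose (TrIdx trBasis)
open Literature.MathematicalPhysics.QuantumFieldTheory.Balaban1983to89.B9Thm34Ext (toB6)
open Literature.MathematicalPhysics.QuantumFieldTheory.Balaban1983to89.B9SectDL2Decay (BlockBd)
open Literature.MathematicalPhysics.QuantumFieldTheory.Balaban1983to89.B9PinMembersKLevelV1 (MemberY geo9Y bg9Y)
open Literature.MathematicalPhysics.QuantumFieldTheory.Balaban1983to89.Node00.OpsYSectDCoords (DvcoKH DvscoKH)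
open Literature.MathematicalPhysics.QuantumFieldTheory.Balaban1983to89.B9Eq346GradGpDivAtPinsL2 (blockBd_DvGcoSDvs_memberY_regime)
open scoped Matrix Matrix.Norms.L2Operator

variable (d ℓ : ℕ) (hd : 1 ≤ d + 1) (hL : Odd (ℓ + 1) ∧ 1 < ℓ + 1) (b₀ b₁ : ℝ) (Mstar N : ℕ) [NeZero N] (c : ℝ) (hc : 0 < c)

/-- **THE THRESHOLD `M₄` OF (3.46)₄ IN BLOCK-`L²`, NAMED**: the first existential constant of dag-n06-w7's `blockBd_DvGcoSDvs_memberY_regime` (a function of the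
member family's data `d ℓ b₀ b₁ M⋆ N` and the class constant `c`).  [cite: Balaban1985BackgroundPropagators, Thm 3.1 (3.46) p.398] -/
def M46 : ℝ := (blockBd_DvGcoSDvs_memberY_regime d ℓ hd hL b₀ b₁ Mstar N hc).choose

/-- **THE SMALLNESS THRESHOLD `a₄` (`M·α₀ ≤ a₄`) OF (3.46)₄ IN BLOCK-`L²`, NAMED** (second existential constant of `blockBd_DvGcoSDvs_memberY_regime`).
[cite: Balaban1985BackgroundPropagators, Thm 3.1 (3.46) p.398, (3.35) p.396] -/
def a46 : ℝ := (blockBd_DvGcoSDvs_memberY_regime d ℓ hd hL b₀ b₁ Mstar N hc).choose_spec.choose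

/-- **THE CONSTANT `B₄` OF (3.46)₄ IN BLOCK-`L²`, NAMED** (third existential constant of `blockBd_DvGcoSDvs_memberY_regime`).
[cite: Balaban1985BackgroundPropagators, Thm 3.1 (3.46) p.398] -/
def B46 : ℝ := (blockBd_DvGcoSDvs_memberY_regime d ℓ hd hL b₀ b₁ Mstar N hc).choose_spec.choose_spec.choose

/-- **THE DECAY RATE `δ₄` OF (3.46)₄ IN BLOCK-`L²`, NAMED** (fourth existential constant of `blockBd_DvGcoSDvs_memberY_regime`) — the closed term the certificate's
side condition `rT ≤ δ₄` refers to.  [cite: Balaban1985BackgroundPropagators, Thm 3.1 (3.46) p.398] -/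
def δ46 : ℝ := (blockBd_DvGcoSDvs_memberY_regime d ℓ hd hL b₀ b₁ Mstar N hc).choose_spec.choose_spec.choose_spec.choose

/-- The defining property of the four named constants (dag-n06-w7's theorem, unpacked once). [cite: Balaban1985BackgroundPropagators, Thm 3.1 (3.46) p.398, bookkeeping] -/
private theorem spec46 : 0 < M46 d ℓ hd hL b₀ b₁ Mstar N c hc ∧ 0 < a46 d ℓ hd hL b₀ b₁ Mstar N c hc ∧ 0 < B46 d ℓ hd hL b₀ b₁ Mstar N c hc ∧ 0 < δ46 d ℓ hd hL b₀ b₁ Mstar N c hc ∧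
    ∀ {G : Subgroup (Matrix (Fin N) (Fin N) ℂ)ˣ} (_ : G ≤ B7Prop2Explicit.unitaryUnits (Matrix (Fin N) (Fin N) ℂ))
      (x : MemberY d ℓ hd hL b₀ b₁ Mstar), M46 d ℓ hd hL b₀ b₁ Mstar N c hc ≤ (geo9Y x).M → ∀ α₀ : ℝ, 0 < α₀ → (geo9Y x).M * α₀ ≤ a46 d ℓ hd hL b₀ b₁ Mstar N c hc →
      ∀ (U : (bg9Y (Matrix (Fin N) (Fin N) ℂ) G x).Cfg), (bg9Y (Matrix (Fin N) (Fin N) ℂ) G x).Reg335 c α₀ U →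
      ∀ {bI : FBondY x.toKIdx → IBondY x.toKIdx} (_ : ∀ f, lvl x.hN x.D x.hk (bI f) = (blkV1 x.hN x.D f).1.1)
        (_ : ∀ f, (geomT x.D).dist (β x.hN x.D x.hk (bI f)) (blkV1 x.hN x.D f) ≤ 1) (R₀ : ℝ) (H₀ : Prop) [Fintype (geo9Y x).Site],
        BlockBd (g := toB6 (geo9Y x) R₀ H₀) (blkBK (κ := TrIdx N) x.toKIdx bI) (blkBK (κ := TrIdx N) x.toKIdx bI)
          (DvcoKH x.toKIdx (trBasis N) (bg9Y (Matrix (Fin N) (Fin N) ℂ) G x) (fun U => U) U ∘ₗ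
            (GcoS x.toKIdx (trBasis N) (bg9Y (Matrix (Fin N) (Fin N) ℂ) G x) (fun U => U) (GpY x.toKIdx (parSymY x.toKIdx)) U ∘ₗ
              DvscoKH x.toKIdx (trBasis N) (bg9Y (Matrix (Fin N) (Fin N) ℂ) G x) (fun U => U) U))
          (fun a a' => B46 d ℓ hd hL b₀ b₁ Mstar N c hc * Real.exp (-(δ46 d ℓ hd hL b₀ b₁ Mstar N c hc * (geo9Y x).dist a a'))) :=
  (blockBd_DvGcoSDvs_memberY_regime d ℓ hd hL b₀ b₁ Mstar N hc).choose_spec.choose_spec.choose_spec.choose_spec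

/-- `0 < M46`. [cite: Balaban1985BackgroundPropagators, Thm 3.1 (3.46) p.398, bookkeeping] -/
theorem M46_pos : 0 < M46 d ℓ hd hL b₀ b₁ Mstar N c hc := (spec46 d ℓ hd hL b₀ b₁ Mstar N c hc).1

/-- `0 < a46`. [cite: Balaban1985BackgroundPropagators, Thm 3.1 (3.46) p.398, bookkeeping] -/
theorem a46_pos : 0 < a46 d ℓ hd hL b₀ b₁ Mstar N c hc := (spec46 d ℓ hd hL b₀ b₁ Mstar N c hc).2.1

/-- `0 < B46`. [cite: Balaban1985BackgroundPropagators, Thm 3.1 (3.46) p.398, bookkeeping] -/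
theorem B46_pos : 0 < B46 d ℓ hd hL b₀ b₁ Mstar N c hc := (spec46 d ℓ hd hL b₀ b₁ Mstar N c hc).2.2.1

/-- `0 < δ46`. [cite: Balaban1985BackgroundPropagators, Thm 3.1 (3.46) p.398, bookkeeping] -/
theorem δ46_pos : 0 < δ46 d ℓ hd hL b₀ b₁ Mstar N c hc := (spec46 d ℓ hd hL b₀ b₁ Mstar N c hc).2.2.2.1

/-- ★★★ **(3.46)₄ FOR `G′` IN BLOCK-`L²` AT THE NAMED CONSTANTS** — dag-n06-w7's `blockBd_DvGcoSDvs_memberY_regime` with its existential constants replaced by the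
closed terms `M46 a46 B46 δ46`: for every member `x`, once `M46 ≤ M_x` and `M_x·α₀ ≤ a46`, at every configuration `U` of the (3.35) class `Reg335 c α₀` and every faithful
index-bond map `bI` (level and unit-distance clauses), the coordinate letter `D_U ∘ G′(U) ∘ D*_U` (`DvcoKH ∘ GcoS (GpY parSymY) ∘ DvscoKH`) has the block-`L²` bound
`‖1_□ D_U G′ D*_U 1_□′‖ ≤ B46·e^{−δ46·d(□,□′)}` over the index-bond block map `blkBK bI`.  This is the type of the N06 certificate's displayed `h46` (after `rw [hblk12 x]`).
[cite: Balaban1985BackgroundPropagators, Thm 3.1 (3.46) p.398, (3.35) p.396; Balaban1984PropagatorsII, (2.46) p.231, (2.51)–(2.54) pp.232–233] -/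
theorem blockBd_DvGcoSDvs_memberY_at {G : Subgroup (Matrix (Fin N) (Fin N) ℂ)ˣ} (hG : G ≤ B7Prop2Explicit.unitaryUnits (Matrix (Fin N) (Fin N) ℂ))
    (x : MemberY d ℓ hd hL b₀ b₁ Mstar) (hM : M46 d ℓ hd hL b₀ b₁ Mstar N c hc ≤ (geo9Y x).M) (α₀ : ℝ) (hα₀ : 0 < α₀)
    (ha : (geo9Y x).M * α₀ ≤ a46 d ℓ hd hL b₀ b₁ Mstar N c hc)
    (U : (bg9Y (Matrix (Fin N) (Fin N) ℂ) G x).Cfg) (hU : (bg9Y (Matrix (Fin N) (Fin N) ℂ) G x).Reg335 c α₀ U)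
    {bI : FBondY x.toKIdx → IBondY x.toKIdx} (hlev : ∀ f, lvl x.hN x.D x.hk (bI f) = (blkV1 x.hN x.D f).1.1)
    (hβ1 : ∀ f, (geomT x.D).dist (β x.hN x.D x.hk (bI f)) (blkV1 x.hN x.D f) ≤ 1) (R₀ : ℝ) (H₀ : Prop) [Fintype (geo9Y x).Site] :
    BlockBd (g := toB6 (geo9Y x) R₀ H₀) (blkBK (κ := TrIdx N) x.toKIdx bI) (blkBK (κ := TrIdx N) x.toKIdx bI)
      (DvcoKH x.toKIdx (trBasis N) (bg9Y (Matrix (Fin N) (Fin N) ℂ) G x) (fun U => U) U ∘ₗ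
        (GcoS x.toKIdx (trBasis N) (bg9Y (Matrix (Fin N) (Fin N) ℂ) G x) (fun U => U) (GpY x.toKIdx (parSymY x.toKIdx)) U ∘ₗ
          DvscoKH x.toKIdx (trBasis N) (bg9Y (Matrix (Fin N) (Fin N) ℂ) G x) (fun U => U) U))
      (fun a a' => B46 d ℓ hd hL b₀ b₁ Mstar N c hc * Real.exp (-(δ46 d ℓ hd hL b₀ b₁ Mstar N c hc * (geo9Y x).dist a a'))) :=
  (spec46 d ℓ hd hL b₀ b₁ Mstar N c hc).2.2.2.2 hG x hM α₀ hα₀ ha U hU hlev hβ1 R₀ H₀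

end Literature.MathematicalPhysics.QuantumFieldTheory.Balaban1983to89.B9Eq346GradGpDivAtPinsL2Closed

end
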